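import Mathlib
import Literature.Combinatorics.Additive.TripleProductProperty
import Literature.Computability.AlgebraicComplexity.GroupTheoreticMatMulThmBProofs
import Literature.Computability.AlgebraicComplexity.PrattTrapezoidValSTPP
import Summits.MatrixMultiplication.MatrixMultiplication.Theorems.GroupTheoreticSTPPCThesisFramePackingZModTwo
import Summits.MatrixMultiplication.MatrixMultiplication.Theorems.GroupTheoreticSTPPCThesisFatPartnersRigidity

/-!
# An STPP family of `(n−1)³`-shaped triples containing a frame triple has at most two members (`n ≥ 6`)

Support file for route `MatrixMultiplication/GroupTheoreticSTPP` (target `CThesis`, stmt-MatrixMultiplication-0593),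
cell `mm-stpp` (D-0046); corollary «T3-fat» of the fat-partner rigidity theorem
(`…FatPartnersRigidity.lean`: a fat partner of the punctured-axes triple is a common translate of `rot` or of
`rot²`) and of the change of basis of `…FramePackingZModTwo.lean`.

* `not_two_translates_rot`, `not_two_translates_rot2` — two members of an STPP family cannot both be
  translates of `(P₁,P₂,P₀)` (resp. of `(P₂,P₀,P₁)`): pattern `(j, j′, j′)` of CKSU Def. 5.1 (ii);
* `not_axes_rot_rot2_translates` — the axes triple, a translate of `rot` and a translate of `rot²` cannot
  coexist: pattern `(i₀, j, j′)` (the translations cancel inside each member);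
* `card_le_two_of_fat_family_with_frame` — **an STPP family in `(ℤ/n)³` (`n ≥ 6`) all of whose members are
  `(n−1)³`-shaped (`|A i| = |B i| = |C i| = n − 1`) and one of whose members is a frame triple (columns of a
  matrix with unit determinant) has at most two members.**  This is, for every `n ≥ 6`, the structural form
  of the engines' certified negatives "axes pinned + two free `(n−1)³` triples is UNSAT in `ℤ₄³`, `ℤ₅³`"
  (eng-1 j241571): the F3 «free» template cannot be mixed with the frame template beyond the CKSU pair.

WHAT THIS IS NOT: nothing about frame-free families of fat triples (CENSUS-PLAN K-F3(b) proper) or about `ω`;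
`n ≤ 5` rests on the census.

## References
* H. Cohn, R. Kleinberg, B. Szegedy, C. Umans, FOCS 2005, Def. 5.1, Prop. 5.2.
-/

-- single-conjunct summit: the mandated namespace repeats `MatrixMultiplication`.
set_option linter.dupNamespace false

namespace Summit.MatrixMultiplication.MatrixMultiplication.Theorems

namespace FatPartners

open Finset Literature.Combinatorics.Additive Literature.Computability.AlgebraicComplexity
open scoped Matrix

variable {n : ℕ} {ι : Type} {A B C : ι → Finset (Fin 3 → ZMod n)}

/-- The point `t + e_k` lies in the punctured line `{v_p = t_p, v_q = t_q, v_k ≠ t_k}` (`n ≥ 2`). [folklore] -/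
theorem single_add_mem (hn : 2 ≤ n) {X : Finset (Fin 3 → ZMod n)} {p q k : Fin 3} (hpk : p ≠ k)
    (hqk : q ≠ k) {t₀ t₁ t₂ : ZMod n}
    (hX : ∀ v, v ∈ X ↔ v p = ![t₀, t₁, t₂] p ∧ v q = ![t₀, t₁, t₂] q ∧ v k ≠ ![t₀, t₁, t₂] k) :
    ![t₀, t₁, t₂] + Pi.single k 1 ∈ X := by
  have h1 : (1 : ZMod n) ≠ 0 := by
    have := FramePackingZMod.natCast_ne_zero_of_lt (n := n) (k := 1) one_pos (by omega)
    simpa using this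
  rw [hX]
  refine ⟨by simp [Pi.single_eq_of_ne hpk], by simp [Pi.single_eq_of_ne hqk], ?_⟩
  simp [h1]

/-- Two members of an STPP family cannot both be translates of `rot = (P₁, P₂, P₀)` (pattern `(j, j′, j′)`).
[cite: CohnKleinbergSzegedyUmans2005, Def. 5.1] -/
theorem not_two_translates_rot (hn : 2 ≤ n) (hS : AddSimultaneousTPP A B C) {j j' : ι} (hjj : j ≠ j')
    {s₀ s₁ s₂ t₀ t₁ t₂ : ZMod n}
    (hAj : ∀ v, v ∈ A j ↔ v 0 = s₀ ∧ v 2 = s₂ ∧ v 1 ≠ s₁) (hCj : ∀ v, v ∈ C j ↔ v 1 = s₁ ∧ v 2 = s₂ ∧ v 0 ≠ s₀)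
    (hAj' : ∀ v, v ∈ A j' ↔ v 0 = t₀ ∧ v 2 = t₂ ∧ v 1 ≠ t₁) (hBj' : (B j').Nonempty)
    (hCj' : ∀ v, v ∈ C j' ↔ v 1 = t₁ ∧ v 2 = t₂ ∧ v 0 ≠ t₀) : False := by
  obtain ⟨b, hb⟩ := hBj'
  have ha : ![s₀, s₁, s₂] + Pi.single 1 1 ∈ A j :=
    single_add_mem hn (p := 0) (q := 2) (k := 1) (by decide) (by decide) (by simpa using hAj)
  have ha' : ![t₀, t₁, t₂] + Pi.single 1 1 ∈ A j' :=
    single_add_mem hn (p := 0) (q := 2) (k := 1) (by decide) (by decide) (by simpa using hAj')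
  have hc : ![t₀, t₁, t₂] + Pi.single 0 1 ∈ C j' :=
    single_add_mem hn (p := 1) (q := 2) (k := 0) (by decide) (by decide) (by simpa using hCj')
  have hc' : ![s₀, s₁, s₂] + Pi.single 0 1 ∈ C j :=
    single_add_mem hn (p := 1) (q := 2) (k := 0) (by decide) (by decide) (by simpa using hCj)
  have key := hS.2 j j' j' _ ha _ ha' b hb b hb _ hc _ hc' (by abel)
  exact hjj key.1

/-- Two members of an STPP family cannot both be translates of `rot² = (P₂, P₀, P₁)`.
[cite: CohnKleinbergSzegedyUmans2005, Def. 5.1] -/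
theorem not_two_translates_rot2 (hn : 2 ≤ n) (hS : AddSimultaneousTPP A B C) {j j' : ι} (hjj : j ≠ j')
    {s₀ s₁ s₂ t₀ t₁ t₂ : ZMod n}
    (hAj : ∀ v, v ∈ A j ↔ v 0 = s₀ ∧ v 1 = s₁ ∧ v 2 ≠ s₂) (hCj : ∀ v, v ∈ C j ↔ v 0 = s₀ ∧ v 2 = s₂ ∧ v 1 ≠ s₁)
    (hAj' : ∀ v, v ∈ A j' ↔ v 0 = t₀ ∧ v 1 = t₁ ∧ v 2 ≠ t₂) (hBj' : (B j').Nonempty)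
    (hCj' : ∀ v, v ∈ C j' ↔ v 0 = t₀ ∧ v 2 = t₂ ∧ v 1 ≠ t₁) : False := by
  obtain ⟨b, hb⟩ := hBj'
  have ha : ![s₀, s₁, s₂] + Pi.single 2 1 ∈ A j :=
    single_add_mem hn (p := 0) (q := 1) (k := 2) (by decide) (by decide) (by simpa using hAj)
  have ha' : ![t₀, t₁, t₂] + Pi.single 2 1 ∈ A j' :=
    single_add_mem hn (p := 0) (q := 1) (k := 2) (by decide) (by decide) (by simpa using hAj')
  have hc : ![t₀, t₁, t₂] + Pi.single 1 1 ∈ C j' :=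
    single_add_mem hn (p := 0) (q := 2) (k := 1) (by decide) (by decide) (by simpa using hCj')
  have hc' : ![s₀, s₁, s₂] + Pi.single 1 1 ∈ C j :=
    single_add_mem hn (p := 0) (q := 2) (k := 1) (by decide) (by decide) (by simpa using hCj)
  have key := hS.2 j j' j' _ ha _ ha' b hb b hb _ hc _ hc' (by abel)
  exact hjj key.1

/-- The axes triple (member `i₀`), a translate of `rot` (member `j`) and a translate of `rot²` (member `j′`)
cannot coexist in an STPP family: pattern `(i₀, j, j′)` with `a = e₀`, `a′ = s + e₁`, `b = s + e₂`,
`b′ = t + e₀`, `c = t + e₁`, `c′ = e₂`. [cite: CohnKleinbergSzegedyUmans2005, Def. 5.1] -/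
theorem not_axes_rot_rot2_translates (hn : 2 ≤ n) (hS : AddSimultaneousTPP A B C) {i₀ j j' : ι}
    (hij : i₀ ≠ j)
    (hA0 : ∀ x, x ∈ A i₀ ↔ x 0 ≠ 0 ∧ ∀ i, i ≠ 0 → x i = 0)
    (hC0 : ∀ x, x ∈ C i₀ ↔ x 2 ≠ 0 ∧ ∀ i, i ≠ 2 → x i = 0)
    {s₀ s₁ s₂ t₀ t₁ t₂ : ZMod n}
    (hAj : ∀ v, v ∈ A j ↔ v 0 = s₀ ∧ v 2 = s₂ ∧ v 1 ≠ s₁) (hBj : ∀ v, v ∈ B j ↔ v 0 = s₀ ∧ v 1 = s₁ ∧ v 2 ≠ s₂)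
    (hBj' : ∀ v, v ∈ B j' ↔ v 1 = t₁ ∧ v 2 = t₂ ∧ v 0 ≠ t₀)
    (hCj' : ∀ v, v ∈ C j' ↔ v 0 = t₀ ∧ v 2 = t₂ ∧ v 1 ≠ t₁) : False := by
  have h1 : (1 : ZMod n) ≠ 0 := by
    have := FramePackingZMod.natCast_ne_zero_of_lt (n := n) (k := 1) one_pos (by omega)
    simpa using this
  have ha : Pi.single 0 (1 : ZMod n) ∈ A i₀ := by
    rw [hA0]; exact ⟨by simp [h1], fun i hi => by simp [Pi.single_eq_of_ne hi]⟩
  have hc' : Pi.single 2 (1 : ZMod n) ∈ C i₀ := by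
    rw [hC0]; exact ⟨by simp [h1], fun i hi => by simp [Pi.single_eq_of_ne hi]⟩
  have ha' : ![s₀, s₁, s₂] + Pi.single 1 1 ∈ A j :=
    single_add_mem hn (p := 0) (q := 2) (k := 1) (by decide) (by decide) (by simpa using hAj)
  have hb : ![s₀, s₁, s₂] + Pi.single 2 1 ∈ B j :=
    single_add_mem hn (p := 0) (q := 1) (k := 2) (by decide) (by decide) (by simpa using hBj)
  have hb' : ![t₀, t₁, t₂] + Pi.single 0 1 ∈ B j' :=
    single_add_mem hn (p := 1) (q := 2) (k := 0) (by decide) (by decide) (by simpa using hBj')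
  have hc : ![t₀, t₁, t₂] + Pi.single 1 1 ∈ C j' :=
    single_add_mem hn (p := 0) (q := 2) (k := 1) (by decide) (by decide) (by simpa using hCj')
  have key := hS.2 i₀ j j' _ ha _ ha' _ hb _ hb' _ hc _ hc' (by abel)
  exact hij key.1

/-- **T3-fat: an STPP family of `(n−1)³`-shaped triples containing a frame triple has at most two members**
(`(ℤ/n)³`, `n ≥ 6`).  After the change of basis making the frame member the punctured-axes triple, every
other member is a fat partner of the axes, hence a translate of `rot` or of `rot²`
(`fat_partner_rigidity`); any two further members then violate CKSU Def. 5.1 (ii).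
[cite: CohnKleinbergSzegedyUmans2005, Def. 5.1 and Prop. 5.2] -/
theorem card_le_two_of_fat_family_with_frame [NeZero n] [Fintype ι] [DecidableEq ι] (hn : 6 ≤ n)
    (hS : AddSimultaneousTPP A B C) (i₀ : ι) {v₀ v₁ v₂ : Fin 3 → ZMod n}
    (hdet : IsUnit (Matrix.det (Matrix.of ![v₀, v₁, v₂])))
    (hA : ∀ x, x ∈ A i₀ ↔ ∃ c : ZMod n, c ≠ 0 ∧ x = c • v₀)
    (hB : ∀ x, x ∈ B i₀ ↔ ∃ c : ZMod n, c ≠ 0 ∧ x = c • v₁)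
    (hC : ∀ x, x ∈ C i₀ ↔ ∃ c : ZMod n, c ≠ 0 ∧ x = c • v₂)
    (hfat : ∀ i, (A i).card = n - 1 ∧ (B i).card = n - 1 ∧ (C i).card = n - 1) :
    Fintype.card ι ≤ 2 := by
  have hn2 : 2 ≤ n := by omega
  -- change of basis as in `FramePackingZMod.card_le_two_of_two_frames`
  set N : Matrix (Fin 3) (Fin 3) (ZMod n) := (Matrix.of ![v₀, v₁, v₂])ᵀ with hN
  have hNdet : IsUnit N.det := by rw [hN, Matrix.det_transpose]; exact hdet
  set M : Matrix (Fin 3) (Fin 3) (ZMod n) := N⁻¹ with hM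
  have hMN : M * N = 1 := Matrix.nonsing_inv_mul N hNdet
  have hMdet : IsUnit M.det := by rw [hM]; exact (Matrix.isUnit_nonsing_inv_det_iff).2 hNdet
  have hMunit : IsUnit M := (Matrix.isUnit_iff_isUnit_det M).2 hMdet
  have hinj : Function.Injective (fun y : Fin 3 → ZMod n => M *ᵥ y) :=
    Matrix.mulVec_injective_of_isUnit hMunit
  have hcol : ∀ k : Fin 3, N *ᵥ Pi.single k 1 = ![v₀, v₁, v₂] k := by
    intro k
    rw [Matrix.mulVec_single_one]
    funext i
    rw [Matrix.col_apply, hN, Matrix.transpose_apply, Matrix.of_apply]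
  have hMv : ∀ k : Fin 3, M *ᵥ (![v₀, v₁, v₂] k) = Pi.single k 1 := by
    intro k
    rw [← hcol k, Matrix.mulVec_mulVec, hMN, Matrix.one_mulVec]
  have hS' : AddSimultaneousTPP (fun i => (A i).image fun y => M *ᵥ y)
      (fun i => (B i).image fun y => M *ᵥ y) (fun i => (C i).image fun y => M *ᵥ y) :=
    addSimultaneousTPP_image_of_reflect hS (fun y => M *ᵥ y) fun a b c a' b' c' h =>
      hinj (by simp only [Matrix.mulVec_add]; exact h)
  have ax : ∀ (k : Fin 3) (X : Finset (Fin 3 → ZMod n)) (v : Fin 3 → ZMod n), M *ᵥ v = Pi.single k 1 →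
      (∀ x, x ∈ X ↔ ∃ c : ZMod n, c ≠ 0 ∧ x = c • v) →
        ∀ x, x ∈ X.image (fun y => M *ᵥ y) ↔ x k ≠ 0 ∧ ∀ j, j ≠ k → x j = 0 := by
    intro k X v hv hX x
    rw [FramePackingZMod.mem_image_mulVec_iff M hX x, hv]
    exact FramePackingZMod.mem_pline_axis_iff (by simp) (fun j hj => by simp [Pi.single_eq_of_ne hj]) x
  have hA0 := ax 0 _ v₀ (hMv 0) hA
  have hB0 := ax 1 _ v₁ (hMv 1) hB
  have hC0 := ax 2 _ v₂ (hMv 2) hC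
  have hcard : ∀ (X : Finset (Fin 3 → ZMod n)), (X.image fun y => M *ᵥ y).card = X.card := fun X =>
    Finset.card_image_of_injective X hinj
  -- every other member of the transported family is a translate of `rot` or `rot²`
  have partner : ∀ j, j ≠ i₀ → ∃ t₀ t₁ t₂ : ZMod n,
      ((∀ v, v ∈ (A j).image (fun y => M *ᵥ y) ↔ v 0 = t₀ ∧ v 2 = t₂ ∧ v 1 ≠ t₁) ∧
        (∀ v, v ∈ (B j).image (fun y => M *ᵥ y) ↔ v 0 = t₀ ∧ v 1 = t₁ ∧ v 2 ≠ t₂) ∧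
        (∀ v, v ∈ (C j).image (fun y => M *ᵥ y) ↔ v 1 = t₁ ∧ v 2 = t₂ ∧ v 0 ≠ t₀)) ∨
      ((∀ v, v ∈ (A j).image (fun y => M *ᵥ y) ↔ v 0 = t₀ ∧ v 1 = t₁ ∧ v 2 ≠ t₂) ∧
        (∀ v, v ∈ (B j).image (fun y => M *ᵥ y) ↔ v 1 = t₁ ∧ v 2 = t₂ ∧ v 0 ≠ t₀) ∧
        (∀ v, v ∈ (C j).image (fun y => M *ᵥ y) ↔ v 0 = t₀ ∧ v 2 = t₂ ∧ v 1 ≠ t₁)) := by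
    intro j hj
    have he : Function.Injective ![i₀, j] := by
      intro x y h
      fin_cases x <;> fin_cases y
      · rfl
      · exact absurd h hj.symm
      · exact absurd h.symm hj.symm
      · rfl
    have hpair := hS'.comp he
    exact fat_partner_rigidity (A := (fun i => (A i).image fun y => M *ᵥ y) ∘ ![i₀, j])
      (B := (fun i => (B i).image fun y => M *ᵥ y) ∘ ![i₀, j])
      (C := (fun i => (C i).image fun y => M *ᵥ y) ∘ ![i₀, j]) hn hA0 hB0 hC0 hpair
      (by simpa [hcard] using (hfat j).1) (by simpa [hcard] using (hfat j).2.1)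
      (by simpa [hcard] using (hfat j).2.2)
  -- three members are too many
  by_contra hlt
  rw [not_le] at hlt
  obtain ⟨j₁, hj₁, j₂, hj₂, h12⟩ : ∃ j₁ ∈ (Finset.univ.erase i₀), ∃ j₂ ∈ (Finset.univ.erase i₀), j₁ ≠ j₂ := by
    apply Finset.one_lt_card.1
    rw [Finset.card_erase_of_mem (Finset.mem_univ _), Finset.card_univ]; omega
  have hj₁' : j₁ ≠ i₀ := (Finset.mem_erase.1 hj₁).1
  have hj₂' : j₂ ≠ i₀ := (Finset.mem_erase.1 hj₂).1
  have hne : ∀ i, ((B i).image fun y => M *ᵥ y).Nonempty := fun i => by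
    rw [← Finset.card_pos, hcard, (hfat i).2.1]; omega
  obtain ⟨s₀, s₁, s₂, ⟨hA₁, hB₁, hC₁⟩ | ⟨hA₁, hB₁, hC₁⟩⟩ := partner j₁ hj₁'
  · obtain ⟨t₀, t₁, t₂, ⟨hA₂, hB₂, hC₂⟩ | ⟨hA₂, hB₂, hC₂⟩⟩ := partner j₂ hj₂'
    · exact not_two_translates_rot hn2 hS' h12 hA₁ hC₁ hA₂ (hne j₂) hC₂
    · exact not_axes_rot_rot2_translates hn2 hS' hj₁'.symm hA0 hC0 hA₁ hB₁ hB₂ hC₂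
  · obtain ⟨t₀, t₁, t₂, ⟨hA₂, hB₂, hC₂⟩ | ⟨hA₂, hB₂, hC₂⟩⟩ := partner j₂ hj₂'
    · exact not_axes_rot_rot2_translates hn2 hS' hj₂'.symm hA0 hC0 hA₂ hB₂ hB₁ hC₁
    · exact not_two_translates_rot2 hn2 hS' h12 hA₁ hC₁ hA₂ (hne j₂) hC₂

end FatPartners

end Summit.MatrixMultiplication.MatrixMultiplication.Theorems
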